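import Mathlib
import HarnessLib
import Literature.MathematicalPhysics.KineticTheory.VelocityFlipNoise

/-!
# Momentum-parity toolkit, III: `L²`-orthogonality of opposite parities and the banded Gram bound
# (line `abel-storage-decay`, crux `VanishingNoiseTransfer.NoisyFourier`, stmt-AtomisticToContinuum-11977, stub B
# `stub_bulkAbelGKPositivity`; part W2 "FlipParity" of the Thomson-witness project of lead c7)

`--supports stmt-AtomisticToContinuum-11977` file (independent of parts I and II, `…ThomsonWitnessParity`, `…ThomsonWitnessParityAux1`). Notation:
`F_m = momentumFlip m` (`p_m ↦ -p_m`) on `PhaseSpace L`; `μ` is any measure with `F_m` measure preserving (every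
Gibbs measure `μ_T = gibbsMeasure` qualifies, `OscillatorChain.measurePreserving_momentumFlip_gibbsMeasure`).

* `integral_eq_zero_of_odd`, `integral_mul_eq_zero_of_odd_even/_of_even_odd` (+ a `_gibbs` version) — an `F_m`-odd
  integrand has integral `0`; functions of opposite `F_m`-parity are orthogonal in `L²(μ)` (no integrability needed).
* `integral_add_sq_of_orthogonal`, `integral_add_sq_of_odd_even` — Pythagoras for two summands.
* `integral_sq_sum_eq_sum_sum`, `integral_sq_sum_of_orthogonal`, `integral_sq_sum_of_odd_even` — `∫ (Σ_m f_m)² = Σ_m ∫ f_m²`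
  for pairwise orthogonal `f_m ∈ L²` (any finite index type, any measure space), in particular when `f_m` is `F_m`-odd and
  `F_{m'}`-even for `m' ≠ m`.
* `card_band_le`, `integral_sq_sum_le_of_banded`, `integral_sq_sum_le_of_banded_parity` — the banded Gram bound
  `∫ (Σ_m f_m)² ≤ (2k+1) Σ_m ∫ f_m²` when `⟨f_m, f_{m'}⟩ = 0` for `|m − m'| > k` (`2ab ≤ a² + b²` on the band, at most
  `2k+1` partners), in particular when `f_m` is `F_m`-odd and `F_m`-parity of `f_{m'}` is even off the band.
* `helper_integralSqSumLeOfBanded` — registered notation-free restatement of `integral_sq_sum_le_of_banded` on phase space.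

References: folklore. No definitions; axioms `propext`, `Classical.choice`, `Quot.sound` only.
-/

noncomputable section

open MeasureTheory
open scoped BigOperators
open Literature.MathematicalPhysics.KineticTheory.HeatConduction

namespace Summit.AtomisticToContinuum.FouriersLaw.Theorems.NoisyFourier.ThomsonWitness.Parity

/-! ## Opposite parities are orthogonal -/

section Orthogonality

variable {L : ℕ} {μ : Measure (PhaseSpace L)} {m : Fin L} {f g : PhaseSpace L → ℝ}

/-- An `F_m`-odd integrand integrates to zero against an `F_m`-invariant measure (no integrability needed: a
non-integrable function has Bochner integral `0`). [folklore] -/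
theorem integral_eq_zero_of_odd (hμ : MeasurePreserving (momentumFlip m) μ μ) {F : PhaseSpace L → ℝ}
    (hF : ∀ x, F (momentumFlip m x) = -F x) : ∫ x, F x ∂μ = 0 := by
  have h := integral_comp_momentumFlip hμ F
  simp only [hF, integral_neg] at h
  linarith

/-- **Orthogonality of opposite parities**: `∫ f g dμ = 0` for `f` `F_m`-odd and `g` `F_m`-even. [folklore] -/
theorem integral_mul_eq_zero_of_odd_even (hμ : MeasurePreserving (momentumFlip m) μ μ)
    (hf : ∀ x, f (momentumFlip m x) = -f x) (hg : ∀ x, g (momentumFlip m x) = g x) :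
    ∫ x, f x * g x ∂μ = 0 :=
  integral_eq_zero_of_odd hμ (F := fun x => f x * g x) fun x => by rw [hf, hg, neg_mul]

/-- `∫ f g dμ = 0` for `f` `F_m`-even and `g` `F_m`-odd. [folklore] -/
theorem integral_mul_eq_zero_of_even_odd (hμ : MeasurePreserving (momentumFlip m) μ μ)
    (hf : ∀ x, f (momentumFlip m x) = f x) (hg : ∀ x, g (momentumFlip m x) = -g x) :
    ∫ x, f x * g x ∂μ = 0 :=
  integral_eq_zero_of_odd hμ (F := fun x => f x * g x) fun x => by rw [hf, hg, mul_neg]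

/-- Gibbs version of the orthogonality of opposite parities (for a single `F_m`-odd integrand under `μ_T` use
`integral_eq_zero_of_odd (P.measurePreserving_momentumFlip_gibbsMeasure L T m)`, landed elsewhere as
`KickDipoleNoCollapse.integral_eq_zero_of_momentumFlip_odd`). [folklore] -/
theorem integral_mul_eq_zero_of_odd_even_gibbs (P : OscillatorChain) (L : ℕ) (T : ℝ) (m : Fin L)
    {f g : PhaseSpace L → ℝ} (hf : ∀ x, f (momentumFlip m x) = -f x) (hg : ∀ x, g (momentumFlip m x) = g x) :
    ∫ x, f x * g x ∂(P.gibbsMeasure L T) = 0 :=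
  integral_mul_eq_zero_of_odd_even (P.measurePreserving_momentumFlip_gibbsMeasure L T m) hf hg

end Orthogonality

/-! ## Pythagoras and the banded Gram bound (pure measure theory) -/

section Gram

variable {Ω : Type*} [MeasurableSpace Ω] {μ : Measure Ω}

/-- Pythagoras for two orthogonal `L²` functions. [folklore] -/
theorem integral_add_sq_of_orthogonal {f g : Ω → ℝ} (hf : MemLp f 2 μ) (hg : MemLp g 2 μ)
    (h0 : ∫ x, f x * g x ∂μ = 0) : ∫ x, (f x + g x) ^ 2 ∂μ = ∫ x, f x ^ 2 ∂μ + ∫ x, g x ^ 2 ∂μ := by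
  have hfg : Integrable (fun x => f x * g x) μ := hf.integrable_mul hg
  have h2 : Integrable (fun x => f x ^ 2 + g x ^ 2) μ := hf.integrable_sq.add hg.integrable_sq
  have h : ∀ x, (f x + g x) ^ 2 = (f x ^ 2 + g x ^ 2) + 2 * (f x * g x) := fun x => by ring
  simp_rw [h]
  rw [integral_add h2 (hfg.const_mul 2), integral_add hf.integrable_sq hg.integrable_sq, integral_const_mul, h0,
    mul_zero, add_zero]

/-- Expanding the square of a finite sum of `L²` functions under the integral. [folklore] -/
theorem integral_sq_sum_eq_sum_sum {ι : Type*} [Fintype ι] (f : ι → Ω → ℝ) (hf : ∀ m, MemLp (f m) 2 μ) :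
    ∫ x, (∑ m, f m x) ^ 2 ∂μ = ∑ m, ∑ m', ∫ x, f m x * f m' x ∂μ := by
  have h : ∀ x, (∑ m, f m x) ^ 2 = ∑ m, ∑ m', f m x * f m' x := fun x => by
    rw [sq, Finset.sum_mul_sum]
  have hint : ∀ m m', Integrable (fun x => f m x * f m' x) μ := fun m m' => (hf m).integrable_mul (hf m')
  simp_rw [h]
  rw [integral_finsetSum _ fun m _ => integrable_finsetSum _ fun m' _ => hint m m']
  exact Finset.sum_congr rfl fun m _ => integral_finsetSum _ fun m' _ => hint m m'

/-- **Pythagoras**: `∫ (Σ_m f_m)² dμ = Σ_m ∫ f_m² dμ` for pairwise orthogonal `f_m ∈ L²(μ)`. [folklore] -/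
theorem integral_sq_sum_of_orthogonal {ι : Type*} [Fintype ι] (f : ι → Ω → ℝ) (hf : ∀ m, MemLp (f m) 2 μ)
    (horth : ∀ m m', m ≠ m' → ∫ x, f m x * f m' x ∂μ = 0) :
    ∫ x, (∑ m, f m x) ^ 2 ∂μ = ∑ m, ∫ x, f m x ^ 2 ∂μ := by
  classical
  rw [integral_sq_sum_eq_sum_sum f hf]
  refine Finset.sum_congr rfl fun m _ => ?_
  rw [Finset.sum_eq_single m (fun m' _ hm' => horth m m' (Ne.symm hm')) (fun h => absurd (Finset.mem_univ m) h)]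
  simp_rw [sq]

/-- The band `{m' : |m − m'| ≤ k}` in `Fin n` has at most `2k + 1` elements. [folklore] -/
theorem card_band_le {n : ℕ} (k c : ℕ) (p : Fin n → Prop) [DecidablePred p]
    (hp : ∀ m, p m → c ≤ m.val + k ∧ m.val ≤ c + k) :
    ((Finset.univ.filter p).card : ℝ) ≤ 2 * k + 1 := by
  have h1 : (Finset.univ.filter p).card ≤ (Finset.Icc (c - k) (c + k)).card := by
    refine Finset.card_le_card_of_injOn (fun m : Fin n => m.val) (fun m hm => ?_) (fun m₁ _ m₂ _ h => Fin.ext h)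
    rw [Finset.mem_coe, Finset.mem_filter] at hm
    simp only [Finset.mem_coe, Finset.mem_Icc]
    have := hp m hm.2
    omega
  rw [Nat.card_Icc] at h1
  have h2 : c + k + 1 - (c - k) ≤ 2 * k + 1 := by omega
  have h3 : ((Finset.univ.filter p).card : ℝ) ≤ ((c + k + 1 - (c - k) : ℕ) : ℝ) := by exact_mod_cast h1
  exact h3.trans (by exact_mod_cast h2)

/-- **Banded Gram bound**: if `f_m ∈ L²(μ)` (`m < n`) and `⟨f_m, f_{m'}⟩_μ = 0` whenever `|m − m'| > k`, then
`∫ (Σ_m f_m)² dμ ≤ (2k + 1) Σ_m ∫ f_m² dμ` (expand, drop the vanishing pairs, `ab ≤ (a² + b²)/2` on the band, each index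
has at most `2k + 1` partners). [folklore] -/
theorem integral_sq_sum_le_of_banded {n : ℕ} (f : Fin n → Ω → ℝ) (k : ℕ) (hf : ∀ m, MemLp (f m) 2 μ)
    (horth : ∀ m m' : Fin n, m.val + k < m'.val ∨ m'.val + k < m.val → ∫ x, f m x * f m' x ∂μ = 0) :
    ∫ x, (∑ m, f m x) ^ 2 ∂μ ≤ (2 * k + 1) * ∑ m, ∫ x, f m x ^ 2 ∂μ := by
  rw [integral_sq_sum_eq_sum_sum f hf]
  set a : Fin n → ℝ := fun m => ∫ x, f m x ^ 2 ∂μ with ha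
  have ha0 : ∀ m, 0 ≤ a m := fun m => integral_nonneg fun x => sq_nonneg _
  -- the band and its symmetric indicator
  set B : Fin n → Fin n → Prop := fun m m' => ¬ (m.val + k < m'.val ∨ m'.val + k < m.val) with hB
  have hBsymm : ∀ m m', B m m' → B m' m := fun m m' h => by
    simp only [hB, not_or, not_lt] at h ⊢
    omega
  -- the pair bound on the band, zero off the band
  have hpair : ∀ m m', ∫ x, f m x * f m' x ∂μ ≤ (a m + a m') / 2 := by
    intro m m'
    have h1 : ∫ x, f m x * f m' x ∂μ ≤ ∫ x, (f m x ^ 2 + f m' x ^ 2) / 2 ∂μ :=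
      integral_mono ((hf m).integrable_mul (hf m')) (((hf m).integrable_sq.add (hf m').integrable_sq).div_const 2)
        fun x => by nlinarith [sq_nonneg (f m x - f m' x)]
    rw [integral_div, integral_add (hf m).integrable_sq (hf m').integrable_sq] at h1
    exact h1
  have hterm : ∀ m m', ∫ x, f m x * f m' x ∂μ ≤
      (if B m m' then 1 else 0) * (a m / 2) + (if B m' m then 1 else 0) * (a m' / 2) := by
    intro m m'
    by_cases h : B m m'
    · rw [if_pos h, if_pos (hBsymm m m' h), one_mul, one_mul, ← add_div]
      exact hpair m m'
    · rw [if_neg h, if_neg (fun h' => h (hBsymm m' m h')), zero_mul, zero_mul, add_zero]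
      exact le_of_eq (horth m m' (not_not.mp h))
  -- at most `2k + 1` partners
  have hcount : ∀ m : Fin n, ∑ m', (if B m m' then (1 : ℝ) else 0) ≤ 2 * k + 1 := by
    intro m
    rw [Finset.sum_boole]
    refine card_band_le k m.val (fun m' => B m m') fun m' hm' => ?_
    simp only [hB, not_or, not_lt] at hm'
    omega
  calc ∑ m, ∑ m', ∫ x, f m x * f m' x ∂μ
      ≤ ∑ m, ∑ m', ((if B m m' then 1 else 0) * (a m / 2) + (if B m' m then 1 else 0) * (a m' / 2)) :=
        Finset.sum_le_sum fun m _ => Finset.sum_le_sum fun m' _ => hterm m m'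
    _ = ∑ m, (∑ m', (if B m m' then (1 : ℝ) else 0)) * a m := by
        rw [Finset.sum_congr rfl fun m _ => Finset.sum_add_distrib, Finset.sum_add_distrib,
          Finset.sum_comm (f := fun m m' => (if B m' m then (1 : ℝ) else 0) * (a m' / 2)), ← Finset.sum_add_distrib]
        refine Finset.sum_congr rfl fun m _ => ?_
        rw [← Finset.sum_mul]
        ring
    _ ≤ ∑ m, (2 * k + 1) * a m := Finset.sum_le_sum fun m _ => mul_le_mul_of_nonneg_right (hcount m) (ha0 m)
    _ = (2 * k + 1) * ∑ m, a m := by rw [Finset.mul_sum]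

end Gram

/-! ## Parity versions on phase space -/

section ParityGram

variable {L : ℕ} {μ : Measure (PhaseSpace L)}

/-- Pythagoras for an `F_m`-odd plus an `F_m`-even `L²` function. [folklore] -/
theorem integral_add_sq_of_odd_even {m : Fin L} (hμ : MeasurePreserving (momentumFlip m) μ μ)
    {f g : PhaseSpace L → ℝ} (hf2 : MemLp f 2 μ) (hg2 : MemLp g 2 μ)
    (hf : ∀ x, f (momentumFlip m x) = -f x) (hg : ∀ x, g (momentumFlip m x) = g x) :
    ∫ x, (f x + g x) ^ 2 ∂μ = ∫ x, f x ^ 2 ∂μ + ∫ x, g x ^ 2 ∂μ :=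
  integral_add_sq_of_orthogonal hf2 hg2 (integral_mul_eq_zero_of_odd_even hμ hf hg)

/-- **`∫ (Σ_m f_m)² = Σ_m ∫ f_m²` when `f_m` is `F_m`-odd and `F_{m}`-even for the other indices**: precisely, `f_m`
odd under `F_m` and `f_{m'}` even under `F_m` for `m' ≠ m` (e.g. `f_m = p_m K_m` with `K_m` even in every momentum
and independent of `p_m`). [folklore] -/
theorem integral_sq_sum_of_odd_even (hμ : ∀ m : Fin L, MeasurePreserving (momentumFlip m) μ μ)
    (f : Fin L → PhaseSpace L → ℝ) (hf : ∀ m, MemLp (f m) 2 μ)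
    (hodd : ∀ m x, f m (momentumFlip m x) = -f m x)
    (heven : ∀ m m', m ≠ m' → ∀ x, f m' (momentumFlip m x) = f m' x) :
    ∫ x, (∑ m, f m x) ^ 2 ∂μ = ∑ m, ∫ x, f m x ^ 2 ∂μ :=
  integral_sq_sum_of_orthogonal f hf fun m m' hmm' =>
    integral_mul_eq_zero_of_odd_even (hμ m) (hodd m) (heven m m' hmm')

/-- **Banded Gram bound, parity form**: if each `f_m ∈ L²(μ)` is `F_m`-odd and `f_{m'}` is `F_m`-even whenever
`|m − m'| > k`, then `∫ (Σ_m f_m)² dμ ≤ (2k + 1) Σ_m ∫ f_m² dμ`. [folklore] -/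
theorem integral_sq_sum_le_of_banded_parity (hμ : ∀ m : Fin L, MeasurePreserving (momentumFlip m) μ μ)
    (f : Fin L → PhaseSpace L → ℝ) (k : ℕ) (hf : ∀ m, MemLp (f m) 2 μ)
    (hodd : ∀ m x, f m (momentumFlip m x) = -f m x)
    (heven : ∀ m m' : Fin L, m.val + k < m'.val ∨ m'.val + k < m.val → ∀ x, f m' (momentumFlip m x) = f m' x) :
    ∫ x, (∑ m, f m x) ^ 2 ∂μ ≤ (2 * k + 1) * ∑ m, ∫ x, f m x ^ 2 ∂μ :=
  integral_sq_sum_le_of_banded f k hf fun m m' hmm' =>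
    integral_mul_eq_zero_of_odd_even (hμ m) (hodd m) (heven m m' hmm')

end ParityGram

/-! ## Registered helper (notation-free restatement) -/

/-- Registered helper sub-goal `helper_integralSqSumLeOfBanded` of crux stmt-AtomisticToContinuum-11977 (line
`abel-storage-decay`, stub B `stub_bulkAbelGKPositivity`, part W2): the banded Gram bound on phase space
(`integral_sq_sum_le_of_banded`, restated). [folklore] -/
theorem helper_integralSqSumLeOfBanded : ∀ (L : ℕ) (μ : MeasureTheory.Measure (Literature.MathematicalPhysics.KineticTheory.HeatConduction.PhaseSpace L)) (f : Fin L → Literature.MathematicalPhysics.KineticTheory.HeatConduction.PhaseSpace L → ℝ) (k : ℕ), (∀ m : Fin L, MeasureTheory.MemLp (f m) 2 μ) → (∀ m m' : Fin L, m.val + k < m'.val ∨ m'.val + k < m.val → MeasureTheory.integral μ (fun x => f m x * f m' x) = 0) → MeasureTheory.integral μ (fun x => (∑ m : Fin L, f m x) ^ 2) ≤ (2 * (k : ℝ) + 1) * ∑ m : Fin L, MeasureTheory.integral μ (fun x => f m x ^ 2) :=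
  fun _ _ f k hf horth => integral_sq_sum_le_of_banded f k hf horth

end Summit.AtomisticToContinuum.FouriersLaw.Theorems.NoisyFourier.ThomsonWitness.Parity

end
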